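import Summits.Parity.GeneralizedHardyLittlewood.Theorems.LiouvilleShiftedTablesSieveToMAvgTypeIIMain

/-!
# Sieve glue for `SieveToMAvg`, part 6c: Type II — the block bound and the sum over pieces

Support file for item stmt-Parity-14274 (route `LiouvilleShiftedTables`).  Continuation of part 6b:
the per-piece bound `|main_{k,q}| ≤ ‖α_k‖ ‖β‖ F*(q)^{1/4}` (blocks over the reduced classes, the
fourth-moment bound of part 5, Cauchy–Schwarz over the classes), its sum over the moduli through
`HypII` (Hölder), and the sum over the pieces `k` (`∑_k ‖α_k‖ ≤ √K₁ ‖α‖`).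
-/

namespace Summit.Parity.GeneralizedHardyLittlewood.Theorems.SieveToMAvg

open Finset Real
open scoped ArithmeticFunction.zeta ArithmeticFunction.sigma
open Literature.NumberTheory.Sieve.BFI

/-! ### Small tools -/

/-- Two finite sums agree when the summand vanishes off the intersection of the index sets. [folklore] -/
theorem sum_eq_sum_of_vanish {s t : Finset ℕ} {f : ℕ → ℝ} (h1 : ∀ a ∈ s, a ∉ t → f a = 0)
    (h2 : ∀ a ∈ t, a ∉ s → f a = 0) : ∑ a ∈ s, f a = ∑ a ∈ t, f a := by
  classical
  calc ∑ a ∈ s, f a = ∑ a ∈ s ∪ t, f a := by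
        refine Finset.sum_subset Finset.subset_union_left fun a ha hna => ?_
        rcases Finset.mem_union.1 ha with h | h
        · exact absurd h hna
        · exact h2 a h hna
    _ = ∑ a ∈ t, f a := by
        refine (Finset.sum_subset Finset.subset_union_right fun a ha hna => ?_).symm
        rcases Finset.mem_union.1 ha with h | h
        · exact h1 a h hna
        · exact absurd h hna

/-- Class sums over distinct reduced residues are bounded by the full sum (nonnegative terms):
`∑_{u ∈ U} ∑_{a ∈ s, a ≡ u (q)} f(a) ≤ ∑_{a ∈ s} f(a)` for `U ⊆ {0,…,q−1}`. [folklore] -/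
theorem sum_classes_le {q : ℕ} (U s : Finset ℕ) (hU : ∀ u ∈ U, u < q) {f : ℕ → ℝ} (hf : ∀ a ∈ s, 0 ≤ f a) :
    ∑ u ∈ U, ∑ a ∈ s.filter (fun a => a ≡ u [MOD q]), f a ≤ ∑ a ∈ s, f a := by
  classical
  have hfil : ∀ u ∈ U, s.filter (fun a => a ≡ u [MOD q]) = s.filter (fun a => a % q = u) := by
    intro u hu
    ext a
    simp only [Finset.mem_filter, Nat.ModEq, Nat.mod_eq_of_lt (hU u hu)]
  rw [Finset.sum_congr rfl fun u hu => by rw [hfil u hu], Finset.sum_fiberwise_eq_sum_filter]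
  exact Finset.sum_le_sum_of_subset_of_nonneg (Finset.filter_subset _ _) fun a ha _ => hf a ha

/-- The same through the injective residue map `v`: for `(h,q) = 1`, `q ≥ 1`,
`∑_{u < q, (u,q)=1} ∑_{b ∈ s, b ≡ v(u) (q)} g(b) ≤ ∑_{b ∈ s} g(b)`. [folklore] -/
theorem sum_classes_vRes_le {h q : ℕ} (hq : 0 < q) (hh : Nat.Coprime h q) (s : Finset ℕ) {g : ℕ → ℝ}
    (hg : ∀ b ∈ s, 0 ≤ g b) :
    ∑ u ∈ (Finset.range q).filter (fun u => Nat.Coprime u q),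
        ∑ b ∈ s.filter (fun b => b ≡ vRes h q u [MOD q]), g b ≤ ∑ b ∈ s, g b := by
  classical
  set U := (Finset.range q).filter (fun u => Nat.Coprime u q) with hU
  set G : ℕ → ℝ := fun w => ∑ b ∈ s.filter (fun b => b ≡ w [MOD q]), g b with hG
  have hinj : Set.InjOn (vRes h q) (U : Set ℕ) := by
    intro u hu u' hu' he
    refine vRes_injOn hq hh ?_ ?_ he
    · simpa [hU] using hu
    · simpa [hU] using hu'
  calc ∑ u ∈ U, G (vRes h q u) = ∑ w ∈ U.image (vRes h q), G w := (Finset.sum_image hinj).symm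
    _ ≤ ∑ w ∈ Finset.range q, G w := by
        refine Finset.sum_le_sum_of_subset_of_nonneg (fun w hw => ?_) fun w _ _ =>
          Finset.sum_nonneg fun b hb => hg b (Finset.mem_of_mem_filter b hb)
        obtain ⟨u, -, rfl⟩ := Finset.mem_image.1 hw
        exact Finset.mem_range.2 (vRes_lt hq u)
    _ ≤ ∑ b ∈ s, g b := sum_classes_le (Finset.range q) s (fun u hu => Finset.mem_range.1 hu) hg

/-! ### The block bound for one piece and one modulus -/

section Block

variable {h q : ℕ} {x X A₂ Δ₁ : ℝ} {α β : ArithmeticFunction ℝ}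

/-- **`|main_{k,q}| ≤ ‖α_k‖ ‖β‖ F*(q)^{1/4}`** for `(q, h) = 1`, `q ≥ 1`, with `lo = boxLow A₂ Δ₁ k ≥ 2`,
`0 < Δ₁ ≤ 1/2`, `0 < x`, `2x ≤ X`, `A₂ ≤ 2x`. [folklore] -/
theorem abs_mainPiece_le (hq : 0 < q) (hqh : Nat.Coprime h q) (hx : 0 < x) (hxX : 2 * x ≤ X) (hA₂x : A₂ ≤ 2 * x)
    (hΔ₁ : 0 < Δ₁) (hΔ₁' : Δ₁ ≤ 1 / 2) (k : ℕ) (hlo : 2 ≤ boxLow A₂ Δ₁ k) :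
    |mainPiece h q x A₂ Δ₁ α β k| ≤
      Real.sqrt (∑ a ∈ Ioc 0 ⌊2 * x⌋₊, (boxRestrict A₂ Δ₁ k α a) ^ 2) *
        Real.sqrt (∑ b ∈ Ioc 0 ⌊2 * x⌋₊, (β b) ^ 2) * Fstar X (-(h : ℤ)) q (boxLow A₂ Δ₁ k) ^ ((1 : ℝ) / 4) := by
  classical
  set N := ⌊2 * x⌋₊ with hN
  set lo := boxLow A₂ Δ₁ k with hlodef
  set c : ℤ := -(h : ℤ) with hc
  set α' : ℕ → ℝ := fun a => boxRestrict A₂ Δ₁ k α a with hα'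
  set β' : ℕ → ℝ := fun b => if colOK x A₂ Δ₁ k b then β b else 0 with hβ'
  set rows : Finset ℕ := Ioc ⌊lo⌋₊ ⌊2 * lo⌋₊ with hrows
  set cols : Finset ℕ := Icc 1 ⌊X / lo⌋₊ with hcols
  set U := (Finset.range q).filter (fun u => Nat.Coprime u q) with hU
  have hΔ' : (-1 : ℝ) < Δ₁ := by linarith
  have hlo0 : 0 < lo := by linarith
  have hhi : boxHigh A₂ Δ₁ k = (1 + Δ₁) * lo := boxHigh_eq_mul_boxLow hΔ' k
  have hA₂pos : 0 < A₂ := by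
    have hl := hlo0
    rw [hlodef] at hl
    unfold boxLow at hl
    exact (div_pos_iff_of_pos_right (by positivity)).1 hl
  -- supports
  have hαsupp : ∀ a, α' a ≠ 0 → lo < a ∧ (a : ℝ) ≤ (1 + Δ₁) * lo := by
    intro a ha
    obtain ⟨hin, -⟩ := boxRestrict_ne_zero ha
    exact ⟨hin.2.1, hhi ▸ hin.2.2⟩
  have hβsupp : ∀ b, β' b ≠ 0 → x < lo * b ∧ (1 + Δ₁) * lo * b ≤ 2 * x := by
    intro b hb
    simp only [hβ'] at hb
    by_cases hcol : colOK x A₂ Δ₁ k b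
    · exact ⟨hcol.1, hhi ▸ hcol.2⟩
    · rw [if_neg hcol] at hb; exact absurd rfl hb
  have hαrows : ∀ a, α' a ≠ 0 → a ∈ rows := by
    intro a ha
    obtain ⟨h1, h2⟩ := hαsupp a ha
    rw [hrows, Finset.mem_Ioc]
    refine ⟨(Nat.floor_lt hlo0.le).2 h1, Nat.le_floor ?_⟩
    nlinarith
  have hαN : ∀ a, α' a ≠ 0 → a ∈ Ioc 0 N := by
    intro a ha
    obtain ⟨h1, h2⟩ := hαsupp a ha
    rw [Finset.mem_Ioc]
    refine ⟨?_, Nat.le_floor ?_⟩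
    · exact_mod_cast hlo0.trans h1
    · have : boxHigh A₂ Δ₁ k ≤ A₂ := by
        unfold boxHigh
        exact div_le_self (by linarith) (one_le_pow₀ (by linarith))
      linarith [hhi.symm.le]
  have hβcols : ∀ b, β' b ≠ 0 → b ∈ cols := by
    intro b hb
    obtain ⟨h1, h2⟩ := hβsupp b hb
    have hb0 : (0 : ℝ) < b := by
      by_contra hle; rw [not_lt] at hle
      have : lo * b ≤ 0 := mul_nonpos_of_nonneg_of_nonpos hlo0.le hle
      linarith
    rw [hcols, Finset.mem_Icc]
    refine ⟨by exact_mod_cast hb0, Nat.le_floor ?_⟩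
    rw [le_div_iff₀ hlo0]
    nlinarith
  have hβN : ∀ b, β' b ≠ 0 → b ∈ Ioc 0 N := by
    intro b hb
    obtain ⟨h1, h2⟩ := hβsupp b hb
    have hb0 : (0 : ℝ) < b := by
      by_contra hle; rw [not_lt] at hle
      have : lo * b ≤ 0 := mul_nonpos_of_nonneg_of_nonpos hlo0.le hle
      linarith
    rw [Finset.mem_Ioc]
    refine ⟨by exact_mod_cast hb0, Nat.le_floor ?_⟩
    have h1lo : 1 ≤ (1 + Δ₁) * lo := by nlinarith
    nlinarith
  -- Step 1: fold `colOK` into `β'` and the weight into `tabM`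
  have hstep1 : mainPiece h q x A₂ Δ₁ α β k =
      ∑ a ∈ Ioc 0 N, ∑ b ∈ Ioc 0 N, (if a * b ≡ h [MOD q] then α' a * tabM c a b * β' b else 0) := by
    unfold mainPiece
    refine Finset.sum_congr rfl fun a _ => Finset.sum_congr rfl fun b _ => ?_
    simp only [hα', hβ', hc]
    by_cases hcol : colOK x A₂ Δ₁ k b
    · by_cases hm : a * b ≡ h [MOD q]
      · rw [if_pos ⟨hcol, hm⟩, if_pos hm, if_pos hcol, tabM_neg_eq_lamW]; ring
      · rw [if_neg (fun h' => hm h'.2), if_neg hm]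
    · rw [if_neg (fun h' => hcol h'.1), if_neg hcol]
      split_ifs <;> ring
  -- Step 2: re-index to rows × cols
  have hstep2 : ∑ a ∈ Ioc 0 N, ∑ b ∈ Ioc 0 N, (if a * b ≡ h [MOD q] then α' a * tabM c a b * β' b else 0) =
      ∑ a ∈ rows, ∑ b ∈ cols, (if a * b ≡ h [MOD q] then α' a * tabM c a b * β' b else 0) := by
    have hin : ∀ a, ∑ b ∈ Ioc 0 N, (if a * b ≡ h [MOD q] then α' a * tabM c a b * β' b else 0) =
        ∑ b ∈ cols, (if a * b ≡ h [MOD q] then α' a * tabM c a b * β' b else 0) := by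
      intro a
      refine sum_eq_sum_of_vanish (fun b _ hb => ?_) (fun b _ hb => ?_)
      · have : β' b = 0 := by by_contra h'; exact hb (hβcols b h')
        simp [this]
      · have : β' b = 0 := by by_contra h'; exact hb (hβN b h')
        simp [this]
    simp_rw [hin]
    refine sum_eq_sum_of_vanish (fun a _ ha => ?_) (fun a _ ha => ?_)
    · have : α' a = 0 := by by_contra h'; exact ha (hαrows a h')
      exact Finset.sum_eq_zero fun b _ => by simp [this]
    · have : α' a = 0 := by by_contra h'; exact ha (hαN a h')
      exact Finset.sum_eq_zero fun b _ => by simp [this]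
  -- Step 3: blocks over the reduced classes
  have hstep3 : ∑ a ∈ rows, ∑ b ∈ cols, (if a * b ≡ h [MOD q] then α' a * tabM c a b * β' b else 0) =
      ∑ u ∈ U, ∑ a ∈ rows.filter (fun a => a ≡ u [MOD q]),
        ∑ b ∈ cols.filter (fun b => b ≡ vRes h q u [MOD q]), α' a * tabM c a b * β' b := by
    rw [Finset.sum_congr rfl fun a _ => Finset.sum_congr rfl fun b _ =>
      indicator_modEq_eq_sum hq hqh a b (α' a * tabM c a b * β' b)]
    rw [Finset.sum_congr rfl fun a _ => Finset.sum_comm, Finset.sum_comm]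
    refine Finset.sum_congr rfl fun u _ => ?_
    rw [Finset.sum_filter]
    refine Finset.sum_congr rfl fun a _ => ?_
    rw [Finset.sum_filter]
    by_cases hau : a ≡ u [MOD q]
    · rw [if_pos hau]
      refine Finset.sum_congr rfl fun b _ => ?_
      by_cases hbv : b ≡ vRes h q u [MOD q]
      · rw [if_pos ⟨hau, hbv⟩, if_pos hbv]
      · rw [if_neg (fun h' => hbv h'.2), if_neg hbv]
    · rw [if_neg hau]
      exact Finset.sum_eq_zero fun b _ => if_neg (fun h' => hau h'.1)
  -- Step 4: each block through the fourth moment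
  have hU : ∀ u ∈ U, u < q ∧ Nat.Coprime u q := fun u hu => by
    simpa [hU] using hu
  have hblock : ∀ u ∈ U,
      |∑ a ∈ rows.filter (fun a => a ≡ u [MOD q]),
          ∑ b ∈ cols.filter (fun b => b ≡ vRes h q u [MOD q]), α' a * tabM c a b * β' b| ≤
        Real.sqrt (∑ a ∈ rows.filter (fun a => a ≡ u [MOD q]), α' a ^ 2) *
          Real.sqrt (∑ b ∈ cols.filter (fun b => b ≡ vRes h q u [MOD q]), β' b ^ 2) *
            Fstar X c q lo ^ ((1 : ℝ) / 4) := by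
    intro u hu
    refine (abs_bilinear_le _ _ (tabM c) α' β').trans ?_
    refine mul_le_mul_of_nonneg_left ?_ (by positivity)
    rw [← tableF_eq_fourthMoment]
    exact Real.rpow_le_rpow (tableF_nonneg _ _ _ _ _ _)
      (tableF_le_Fstar X c lo (hU u hu).1 (vRes_lt hq u)) (by norm_num)
  -- Step 5: Cauchy–Schwarz over the classes
  rw [hstep1, hstep2, hstep3]
  refine (Finset.abs_sum_le_sum_abs _ _).trans ((Finset.sum_le_sum hblock).trans ?_)
  rw [← Finset.sum_mul]
  have hF0 : 0 ≤ Fstar X c q lo ^ ((1 : ℝ) / 4) := Real.rpow_nonneg (Fstar_nonneg _ _ _ _) _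
  refine mul_le_mul_of_nonneg_right ?_ hF0
  refine (Real.sum_sqrt_mul_sqrt_le U (fun u => Finset.sum_nonneg fun _ _ => sq_nonneg _)
    (fun u => Finset.sum_nonneg fun _ _ => sq_nonneg _)).trans ?_
  refine mul_le_mul (Real.sqrt_le_sqrt ?_) (Real.sqrt_le_sqrt ?_) (Real.sqrt_nonneg _) (Real.sqrt_nonneg _)
  · -- `α`-side
    calc ∑ u ∈ U, ∑ a ∈ rows.filter (fun a => a ≡ u [MOD q]), α' a ^ 2
        ≤ ∑ a ∈ rows, α' a ^ 2 := sum_classes_le U rows (fun u hu => (hU u hu).1) fun a _ => sq_nonneg _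
      _ = ∑ a ∈ Ioc 0 N, α' a ^ 2 := by
          refine sum_eq_sum_of_vanish (fun a _ ha => ?_) (fun a _ ha => ?_)
          · have : α' a = 0 := by by_contra h'; exact ha (hαN a h')
            simp [this]
          · have : α' a = 0 := by by_contra h'; exact ha (hαrows a h')
            simp [this]
  · -- `β`-side
    calc ∑ u ∈ U, ∑ b ∈ cols.filter (fun b => b ≡ vRes h q u [MOD q]), β' b ^ 2
        ≤ ∑ b ∈ cols, β' b ^ 2 := sum_classes_vRes_le hq hqh cols fun b _ => sq_nonneg _
      _ = ∑ b ∈ Ioc 0 N, β' b ^ 2 := by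
          refine sum_eq_sum_of_vanish (fun b _ hb => ?_) (fun b _ hb => ?_)
          · have : β' b = 0 := by by_contra h'; exact hb (hβN b h')
            simp [this]
          · have : β' b = 0 := by by_contra h'; exact hb (hβcols b h')
            simp [this]
      _ ≤ ∑ b ∈ Ioc 0 N, β b ^ 2 := by
          refine Finset.sum_le_sum fun b _ => ?_
          simp only [hβ']
          split_ifs
          · exact le_rfl
          · simpa using sq_nonneg (β b)

end Block

end Summit.Parity.GeneralizedHardyLittlewood.Theorems.SieveToMAvg
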